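import Literature.AlgebraicGeometry.Motives.MumfordTateInvariantsStableSubspace
import Literature.AlgebraicGeometry.Motives.ZarhinHodgeGroupLieAlgebra
import HarnessLib

/-!
# A rational subspace `𝔞 ⊆ End V` stable under conjugation by `MT(H)(ℚ)` is normalised by the Hodge Lie algebra:
# `[𝔥(H), 𝔞] ⊆ 𝔞` (Green–Griffiths–Kerr (I.B.3)/(I.B.5) on `T^{1,1} = End V`, Lie-algebra form)

Family `hodge`, layer `Literature/AlgebraicGeometry/Motives`.  THEOREMS ONLY (no definition, no named fact).  Written for the
cell `pub-hodgecm2` (COR-CM), seat `b27` gen 54 (count-neutral Mumford–Tate-rank ladder, «rigidity modulo the centre», part 1).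

For a pure `ℚ`-Hodge structure `H` on a finite-dimensional `V`, the tree knows (lane `lit-hodgefound`,
`Motives/MumfordTateInvariantsStableSubspace`): a rational subspace `W ⊆ T^{a,b} V` stable under `ρ_{a,b}(MT(H)(ℚ))` is stable
under the derivation action `ρ_{a,b}(X)` of every `X` in the Lie stabiliser `𝔰(H) ⊇ 𝔥(H)`.  HERE the same statement for
`End V` with the CONJUGATION action: if `g A g⁻¹ ∈ 𝔞` for all `g ∈ MT(H)(ℚ)`, `A ∈ 𝔞`, then `X A − A X ∈ 𝔞` for all `X ∈ 𝔰(H)`,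
in particular for all `X ∈ 𝔥(H)` (**`commutator_mem_of_forall_mumfordTateGroup_conj_mem`**, `…_of_mem_hodgeLie`).  The transport
`End V → T^{1,1} V = V ⊗ V^∨` is the coordinate tensor `A ↦ t_A = Σ_i (A b_i) ⊗ b_i^*` of a basis `(b_i)` (§1, over any field):
`t_A` absorbs right composition (`sum_tprod_apply_tmul_tprod_coord_comp`), `ρ_{1,1}(X) t_A = t_{XA − AX}`
(`tensorDerivation_sum_tprod_apply_tmul_tprod_coord`), `ρ_{1,1}(g) t_A = t_{g A g⁻¹}` (`tensorSpaceActOver_sum_tprod_apply_tmul_tprod_coord`),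
and `A ↦ t_A` is injective (`eq_of_sum_tprod_apply_tmul_tprod_coord_eq`).

## References
* [GreenGriffithsKerr2012] M. Green, P. Griffiths, M. Kerr, *Mumford–Tate Groups and Domains* (2012), §I.B (I.B.3), (I.B.5).
  [cite: GreenGriffithsKerr2012, §I.B (I.B.3) and (I.B.5)]
* [Deligne1982HodgeCycles] P. Deligne, *Hodge cycles on abelian varieties*, LNM 900 (1982), I §3.1 and Prop. 3.4.
  [cite: Deligne1982HodgeCycles, I §3.1 and Prop. 3.4]
* [Borel1991] A. Borel, *Linear Algebraic Groups*, 2nd ed. (1991), §3.8–3.9 (the Lie algebra of a stabiliser). [cite: Borel1991, §3.9]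
-/

noncomputable section

open scoped TensorProduct PiTensorProduct

namespace Literature.AlgebraicGeometry.Motives

universe u v w

/-! ### §1 The coordinate tensor `t_A = Σ_i (A b_i) ⊗ b_i^* ∈ T^{1,1}` of an endomorphism -/

section CoordTensor

variable {K : Type u} [Field K] {W : Type v} [AddCommGroup W] [Module K W] {ι : Type w} [Fintype ι]

/-- Linearity of `y ↦ ⊗(y)` in rank one: `⊗(Σ cᵢ xᵢ) = Σ cᵢ ⊗(xᵢ)` (any field). [folklore] -/
private theorem tprod_fin_one_sum_smul {M : Type*} [AddCommGroup M] [Module K M] {κ : Type*} (s : Finset κ) (c : κ → K) (x : κ → M) :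
    PiTensorProduct.tprod K (fun _ : Fin 1 => ∑ i ∈ s, c i • x i) = ∑ i ∈ s, c i • PiTensorProduct.tprod K (fun _ : Fin 1 => x i) := by
  simp_rw [← PiTensorProduct.subsingletonEquiv_symm_apply' (R := K) (0 : Fin 1)]
  rw [map_sum]
  simp_rw [map_smul]

/-- Additivity of `y ↦ ⊗(y)` in rank one. [folklore] -/
private theorem tprod_fin_one_add {M : Type*} [AddCommGroup M] [Module K M] (x y : M) :
    PiTensorProduct.tprod K (fun _ : Fin 1 => x + y) =
      PiTensorProduct.tprod K (fun _ : Fin 1 => x) + PiTensorProduct.tprod K (fun _ : Fin 1 => y) := by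
  simp_rw [← PiTensorProduct.subsingletonEquiv_symm_apply' (R := K) (0 : Fin 1)]
  rw [map_add]

/-- `K`-homogeneity of `y ↦ ⊗(y)` in rank one. [folklore] -/
private theorem tprod_fin_one_smul {M : Type*} [AddCommGroup M] [Module K M] (c : K) (x : M) :
    PiTensorProduct.tprod K (fun _ : Fin 1 => c • x) = c • PiTensorProduct.tprod K (fun _ : Fin 1 => x) := by
  simp_rw [← PiTensorProduct.subsingletonEquiv_symm_apply' (R := K) (0 : Fin 1)]
  rw [map_smul]

/-- Subtraction under `y ↦ ⊗(y)` in rank one. [folklore] -/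
private theorem tprod_fin_one_sub {M : Type*} [AddCommGroup M] [Module K M] (x y : M) :
    PiTensorProduct.tprod K (fun _ : Fin 1 => x - y) =
      PiTensorProduct.tprod K (fun _ : Fin 1 => x) - PiTensorProduct.tprod K (fun _ : Fin 1 => y) := by
  simp_rw [← PiTensorProduct.subsingletonEquiv_symm_apply' (R := K) (0 : Fin 1)]
  rw [map_sub]

/-- **The coordinate tensor absorbs right composition**: `Σ_i (M b_i) ⊗ (b_i^* ∘ N) = Σ_i (M N b_i) ⊗ b_i^*` — both are the
image of `M N` under `End W ≅ W ⊗ W^∨` (expand `b_i^* ∘ N` and `N b_i` in the dual bases). [cite: Deligne1982HodgeCycles, I §3.1] -/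
theorem sum_tprod_apply_tmul_tprod_coord_comp (b : Module.Basis ι K W) (M N : Module.End K W) :
    ∑ i, PiTensorProduct.tprod K (fun _ : Fin 1 => M (b i)) ⊗ₜ[K] PiTensorProduct.tprod K (fun _ : Fin 1 => (b.coord i).comp N) =
      ∑ i, PiTensorProduct.tprod K (fun _ : Fin 1 => M (N (b i))) ⊗ₜ[K] PiTensorProduct.tprod K (fun _ : Fin 1 => b.coord i) := by
  classical
  -- expand `b_i^* ∘ N = Σ_j N_{ij} b_j^*` and `M N b_i = Σ_j N_{ji} M b_j`
  have hL : ∀ i, (b.coord i).comp N = ∑ j, (b.coord i (N (b j))) • b.coord j := fun i =>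
    (b.sum_dual_apply_smul_coord ((b.coord i).comp N)).symm
  have hR : ∀ i, M (N (b i)) = ∑ j, (b.coord j (N (b i))) • M (b j) := by
    intro i
    conv_lhs => rw [← b.sum_repr (N (b i))]
    rw [map_sum]
    refine Finset.sum_congr rfl fun j _ => ?_
    rw [map_smul, Module.Basis.coord_apply]
  simp_rw [hL, hR, tprod_fin_one_sum_smul, TensorProduct.tmul_sum, TensorProduct.sum_tmul, TensorProduct.tmul_smul,
    TensorProduct.smul_tmul']
  rw [Finset.sum_comm]

/-- **The derivation action on the coordinate tensor is the commutator**: `ρ_{1,1}(X) t_A = t_{XA − AX}`.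
[cite: Borel1991, §3.9] [cite: Deligne1982HodgeCycles, I §3.1] -/
theorem tensorDerivation_sum_tprod_apply_tmul_tprod_coord (b : Module.Basis ι K W) (X A : Module.End K W) :
    tensorDerivation 1 1 X
        (∑ i, PiTensorProduct.tprod K (fun _ : Fin 1 => A (b i)) ⊗ₜ[K] PiTensorProduct.tprod K (fun _ : Fin 1 => b.coord i)) =
      ∑ i, PiTensorProduct.tprod K (fun _ : Fin 1 => (X * A - A * X) (b i)) ⊗ₜ[K] PiTensorProduct.tprod K (fun _ : Fin 1 => b.coord i) := by
  classical
  rw [map_sum]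
  have hD : ∀ i, tensorDerivation 1 1 X
      (PiTensorProduct.tprod K (fun _ : Fin 1 => A (b i)) ⊗ₜ[K] PiTensorProduct.tprod K (fun _ : Fin 1 => b.coord i)) =
      PiTensorProduct.tprod K (fun _ : Fin 1 => X (A (b i))) ⊗ₜ[K] PiTensorProduct.tprod K (fun _ : Fin 1 => b.coord i) -
        PiTensorProduct.tprod K (fun _ : Fin 1 => A (b i)) ⊗ₜ[K] PiTensorProduct.tprod K (fun _ : Fin 1 => (b.coord i).comp X) := by
    intro i
    rw [tensorDerivation_tmul_tprod, Fin.sum_univ_one, Fin.sum_univ_one]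
    congr 3
    · funext m; simp [Fin.fin_one_eq_zero m]
    · funext m; simp [Fin.fin_one_eq_zero m]
  simp_rw [hD]
  rw [Finset.sum_sub_distrib, sum_tprod_apply_tmul_tprod_coord_comp b A X, ← Finset.sum_sub_distrib]
  refine Finset.sum_congr rfl fun i _ => ?_
  rw [← TensorProduct.sub_tmul, ← tprod_fin_one_sub]
  rfl

/-- **The action of `g ∈ GL(W)` on the coordinate tensor is conjugation**: `ρ_{1,1}(g) t_A = t_{g A g⁻¹}`.
[cite: GreenGriffithsKerr2012, §I.B (I.B.3) and (I.B.5)] [cite: Deligne1982HodgeCycles, I §3.1] -/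
theorem tensorSpaceActOver_sum_tprod_apply_tmul_tprod_coord (b : Module.Basis ι K W) (g : W ≃ₗ[K] W) (A : Module.End K W) :
    tensorSpaceActOver g
        (∑ i, PiTensorProduct.tprod K (fun _ : Fin 1 => A (b i)) ⊗ₜ[K] PiTensorProduct.tprod K (fun _ : Fin 1 => b.coord i)) =
      ∑ i, PiTensorProduct.tprod K (fun _ : Fin 1 => ((g : W →ₗ[K] W) ∘ₗ A ∘ₗ (g.symm : W →ₗ[K] W)) (b i)) ⊗ₜ[K]
        PiTensorProduct.tprod K (fun _ : Fin 1 => b.coord i) := by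
  classical
  rw [map_sum]
  simp_rw [tensorSpaceActOver_tmul_tprod]
  have h := sum_tprod_apply_tmul_tprod_coord_comp b ((g : W →ₗ[K] W) ∘ₗ A) (g.symm : W →ₗ[K] W)
  simp only [LinearMap.comp_apply, LinearEquiv.coe_coe] at h ⊢
  exact h

/-- The test functionals `μ_{f,v} : T^{1,1} → K`, `(⊗x) ⊗ (⊗φ) ↦ f(x₀) · φ₀(v)`. [folklore] -/
private theorem exists_functional_tprod_tmul_tprod (f : Module.Dual K W) (v : W) :
    ∃ μ : hodgeTensorSpaceOver K W 1 1 →ₗ[K] K, ∀ (x : Fin 1 → W) (φ : Fin 1 → Module.Dual K W),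
      μ (PiTensorProduct.tprod K x ⊗ₜ[K] PiTensorProduct.tprod K φ) = f (x 0) * φ 0 v := by
  refine ⟨LinearMap.mul' K K ∘ₗ TensorProduct.map
      (PiTensorProduct.lift ((MultilinearMap.mkPiAlgebra K (Fin 1) K).compLinearMap fun _ => f))
      (PiTensorProduct.lift ((MultilinearMap.mkPiAlgebra K (Fin 1) K).compLinearMap fun _ => Module.Dual.eval K W v)),
    fun x φ => ?_⟩
  simp [MultilinearMap.mkPiAlgebra_apply, Module.Dual.eval_apply]

/-- `μ_{f,v}(t_A) = f(A v)`. [folklore] -/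
private theorem functional_sum_tprod_apply_tmul_tprod_coord (b : Module.Basis ι K W) (f : Module.Dual K W) (v : W)
    {μ : hodgeTensorSpaceOver K W 1 1 →ₗ[K] K}
    (hμ : ∀ (x : Fin 1 → W) (φ : Fin 1 → Module.Dual K W), μ (PiTensorProduct.tprod K x ⊗ₜ[K] PiTensorProduct.tprod K φ) = f (x 0) * φ 0 v)
    (A : Module.End K W) :
    μ (∑ i, PiTensorProduct.tprod K (fun _ : Fin 1 => A (b i)) ⊗ₜ[K] PiTensorProduct.tprod K (fun _ : Fin 1 => b.coord i)) = f (A v) := by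
  rw [map_sum]
  simp_rw [hμ]
  conv_rhs => rw [← b.sum_repr v, map_sum, map_sum]
  refine Finset.sum_congr rfl fun i _ => ?_
  rw [map_smul, map_smul, smul_eq_mul, mul_comm, Module.Basis.coord_apply]

/-- **`A ↦ t_A` is injective** (`End W ≅ W ⊗ W^∨ = T^{1,1}`). [cite: Deligne1982HodgeCycles, I §3.1] -/
theorem eq_of_sum_tprod_apply_tmul_tprod_coord_eq (b : Module.Basis ι K W) {A A' : Module.End K W}
    (h : ∑ i, PiTensorProduct.tprod K (fun _ : Fin 1 => A (b i)) ⊗ₜ[K] PiTensorProduct.tprod K (fun _ : Fin 1 => b.coord i) =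
      ∑ i, PiTensorProduct.tprod K (fun _ : Fin 1 => A' (b i)) ⊗ₜ[K] PiTensorProduct.tprod K (fun _ : Fin 1 => b.coord i)) :
    A = A' := by
  refine LinearMap.ext fun v => ?_
  rw [← sub_eq_zero]
  refine (Module.forall_dual_apply_eq_zero_iff K (A v - A' v)).1 fun f => ?_
  obtain ⟨μ, hμ⟩ := exists_functional_tprod_tmul_tprod f v
  have h1 := functional_sum_tprod_apply_tmul_tprod_coord b f v hμ A
  have h2 := functional_sum_tprod_apply_tmul_tprod_coord b f v hμ A'
  rw [h] at h1
  rw [map_sub, ← h1, ← h2, sub_self]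

/-- **The coordinate tensor as a linear map** `End W → T^{1,1} W`. [folklore] -/
private theorem exists_linearMap_sum_tprod_apply_tmul_tprod_coord (b : Module.Basis ι K W) :
    ∃ τ : Module.End K W →ₗ[K] hodgeTensorSpaceOver K W 1 1, ∀ A,
      τ A = ∑ i, PiTensorProduct.tprod K (fun _ : Fin 1 => A (b i)) ⊗ₜ[K] PiTensorProduct.tprod K (fun _ : Fin 1 => b.coord i) := by
  refine ⟨{ toFun := fun A => ∑ i, PiTensorProduct.tprod K (fun _ : Fin 1 => A (b i)) ⊗ₜ[K] PiTensorProduct.tprod K (fun _ : Fin 1 => b.coord i)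
            map_add' := fun A A' => ?_
            map_smul' := fun c A => ?_ }, fun A => rfl⟩
  · simp_rw [LinearMap.add_apply, tprod_fin_one_add, TensorProduct.add_tmul]
    rw [Finset.sum_add_distrib]
  · simp_rw [LinearMap.smul_apply, tprod_fin_one_smul, RingHom.id_apply, Finset.smul_sum, TensorProduct.smul_tmul']

end CoordTensor

/-! ### §2 Conjugation-stable subspaces of `End V` are `ad 𝔥(H)`-stable -/

namespace HodgeStructure

variable {V : Type u} [AddCommGroup V] [Module ℚ V] [Module.Finite ℚ V] [HodgeTensorFacts.{u, u}] {n : ℤ}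

/-- **A rational subspace `𝔞 ⊆ End V` stable under conjugation by `MT(H)(ℚ)` is normalised by the Lie stabiliser `𝔰(H)`**:
`X A − A X ∈ 𝔞` for `X ∈ 𝔰(H)`, `A ∈ 𝔞`.  The coordinate tensor `A ↦ t_A` carries `𝔞` onto a `ρ_{1,1}(MT(H)(ℚ))`-stable subspace of
`T^{1,1} V` (`ρ_{1,1}(g) t_A = t_{gAg⁻¹}`), which is `ρ_{1,1}(𝔰)`-stable (`tensorDerivation_apply_mem_of_mumfordTateGroup_stable`), and
`ρ_{1,1}(X) t_A = t_{XA−AX}`. [cite: GreenGriffithsKerr2012, §I.B (I.B.3) and (I.B.5)] [cite: Borel1991, §3.9] -/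
theorem commutator_mem_of_forall_mumfordTateGroup_conj_mem (H : HodgeStructure V n) (𝔞 : Submodule ℚ (Module.End ℚ V))
    (h𝔞 : ∀ g ∈ H.mumfordTateGroup, ∀ A ∈ 𝔞, (g : V →ₗ[ℚ] V) ∘ₗ A ∘ₗ (g.symm : V →ₗ[ℚ] V) ∈ 𝔞)
    {X : Module.End ℚ V} (hX : X ∈ H.lieStabilizer) {A : Module.End ℚ V} (hA : A ∈ 𝔞) : X * A - A * X ∈ 𝔞 := by
  classical
  set b := Module.finBasis ℚ V with hb
  obtain ⟨τ, hτ⟩ := exists_linearMap_sum_tprod_apply_tmul_tprod_coord (K := ℚ) b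
  set W : Submodule ℚ (hodgeTensorSpace V 1 1) := 𝔞.map τ with hW
  have hWst : ∀ g ∈ H.mumfordTateGroup, ∀ w ∈ W, tensorSpaceAct g w ∈ W := by
    intro g hg w hw
    obtain ⟨B, hB, rfl⟩ := Submodule.mem_map.1 hw
    refine Submodule.mem_map.2 ⟨(g : V →ₗ[ℚ] V) ∘ₗ B ∘ₗ (g.symm : V →ₗ[ℚ] V), h𝔞 g hg B hB, ?_⟩
    rw [hτ, hτ, ← tensorSpaceActOver_rat, tensorSpaceActOver_sum_tprod_apply_tmul_tprod_coord]
  have hmem : tensorDerivation 1 1 X (τ A) ∈ W :=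
    tensorDerivation_apply_mem_of_mumfordTateGroup_stable H W hWst hX (Submodule.mem_map.2 ⟨A, hA, rfl⟩)
  rw [hτ, tensorDerivation_sum_tprod_apply_tmul_tprod_coord, ← hτ] at hmem
  obtain ⟨B, hB, hBe⟩ := Submodule.mem_map.1 hmem
  rw [hτ, hτ] at hBe
  rwa [← eq_of_sum_tprod_apply_tmul_tprod_coord_eq b hBe]

/-- **… in particular `[𝔥(H), 𝔞] ⊆ 𝔞`** (`𝔥(H) ⊆ 𝔰(H)`, `hodgeLie_le_lieStabilizer`). [cite: GreenGriffithsKerr2012, §I.B (I.B.3) and (I.B.5)] -/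
theorem commutator_mem_of_forall_mumfordTateGroup_conj_mem_of_mem_hodgeLie (H : HodgeStructure V n)
    (𝔞 : Submodule ℚ (Module.End ℚ V))
    (h𝔞 : ∀ g ∈ H.mumfordTateGroup, ∀ A ∈ 𝔞, (g : V →ₗ[ℚ] V) ∘ₗ A ∘ₗ (g.symm : V →ₗ[ℚ] V) ∈ 𝔞)
    {X : Module.End ℚ V} (hX : X ∈ H.hodgeLie) {A : Module.End ℚ V} (hA : A ∈ 𝔞) : X * A - A * X ∈ 𝔞 :=
  commutator_mem_of_forall_mumfordTateGroup_conj_mem H 𝔞 h𝔞 (hodgeLie_le_lieStabilizer H hX) hA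

end HodgeStructure

end Literature.AlgebraicGeometry.Motives

end
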